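import Summits.BirchSwinnertonDyer.BirchSwinnertonDyer.Theorems.AlignedTransportAtTwoMainConjectureOfRankZeroBSDAtTwoLayerValueBoundary
import Summits.BirchSwinnertonDyer.BirchSwinnertonDyer.Theorems.AlignedTransportAtTwoMainConjectureOfRankZeroBSDAtTwoTwinValueLambda
import HarnessLib

/-!
# Route `AlignedTransportAtTwo`, crux C2 `MainConjectureOfRankZeroBSDAtTwo` (stmt-BirchSwinnertonDyer-22298):
# THE LAYER-VALUE DOOR — `μ(X(W/ℚ_∞)) = 0` from ONE VALUE `|f_X(z)|₂ ≥ 1/2` of a generator of `char_Λ X` at ANY point of the open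
# disc (e.g. `z = ζ − 1` at ANY layer of the cyclotomic tower), by Greenberg's Euler characteristic (KERNEL) alone — no `ι`, no PRINT
# Thm. 1.14, no rational point, no twist; at a layer the boundary value `|f_X(ζ_{2ⁿ⁺¹} − 1)|₂ = 1/2` pins `λ(X) = 2ⁿ` as well

HONEST FRAMING (cell `bsd-f1-sign2`, WIDTH-5 attached prover seat `bsd-line-att-p5` gen 50 on line `birth` of the lead
`bsd-line-att-p2`; `--supports` stmt-BirchSwinnertonDyer-22298, closes nothing; BSD is NOT proved by any of this; the crux C2, its
verdict «blocked-on `Rank1Residual.GreenbergMuConjectureIrreducible`» and every registered stub (P / T / Kμ / LimDoor / MuIneqʳ / PFμ⁺)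
are untouched). THEOREMS ONLY — no `def`, no instance, no named fact, no `sorry`. Greenberg's Thm. 4.1 is the KERNEL theorem
`thm41_charValue_rankZero_anyPrime_holds` (cell bsd-2adic) read through g37's `norm_constantCoeff_charGen_eq_of_thm41`; the Λ-algebra is
the sibling `…LayerValueBoundary` (the closed / boundary one-value certificate, any `p`).

THE POINT. For `W/ℚ` globally minimal, good ordinary at `2`, `Sel_{2^∞}(W/ℚ)` finite, every generator `f_X` of `char_Λ X(W/ℚ_∞)` has
`‖f_X(0)‖₂ = 2^{−w}` with the Euler weight `w = ord₂ ∏c_ℓ + 2e + s − 2t` (`#Ẽ(𝔽₂)[2^∞] = 2^e`, `#Sel_{2^∞}(W/ℚ) = 2^s`, `#W(ℚ)[2^∞] = 2^t`;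
Thm. 4.1). On C2's cell `t = 0` and `e ≥ 1`, so **`w ≠ 1` automatically** — exactly the side condition of the closed certificate
`…LayerValueBoundary.mu_eq_zero_of_inv_le_norm_tsum`. Hence:

* §1 (datum level) ★★★ `mu_eq_zero_of_layerValue`: `w ≠ 1` and **`‖f_X(z)‖₂ ≥ 1/2` at ONE point `|z| < 1` of `ℂ₂ ⟹ μ(X(W/ℚ_∞)) = 0`**;
  ★★★ `mu_eq_zero_and_lambda_eq_of_layerValue_eq`: at a layer, **`‖f_X(ζ − 1)‖₂ = 1/2` for `ζ` of order `2ⁿ⁺¹` ⟹ `μ(X) = 0 ∧ λ(X) = 2ⁿ`**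
  (`λ(X) = 2` from a primitive fourth root of unity: `…_of_layerTwoValue`); ★★ EXACTNESS `norm_charGen_layer_eq_inv_of_lambda_eq`: conversely
  `μ(X) = 0`, `λ(X) = 2ⁿ`, `w ≥ 2` ⟹ `‖f_X(ζ_{2ⁿ⁺¹} − 1)‖₂ = 1/2` for EVERY generator — the door at layer `n+1` is EXACTLY the locus `λ(X) = 2ⁿ`
  (given `μ = 0`), one layer below the tree's strict certificate (which reads `λ = 2ⁿ` first at layer `n+2`).
* §2 (the seed cell, modulo PRINT {`h17` Kato 17.4 (1)(2), `hper`, `hmod`, `hGZK`} and C2's own binders `r_an = 0`, `BSD(W,2)`, good ordinary,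
  no rational `2`-torsion — NO `h114`) ★★★ `mazurMainConjecture_two_of_bsdp_of_layerValue`: the LAYER VALUE displayed at every normalised datum
  (`∃` generator `f_X` and `∃ |z| < 1` with `‖f_X(z)‖₂ ≥ 1/2`), `w ≠ 1` ⟹ **`MazurMainConjecture W 2`**; layer form `…_of_layerValue_eq`.

READING (not used in any proof; memo `Cruxes/MainConjectureOfRankZeroBSDAtTwo/LAYER-VALUE-att-p5-g50.md`). `V_{n+1} := 2ⁿ·ord₂ f_X(ζ_{2ⁿ⁺¹} − 1)`
is the growth `e(W/ℚ_{n+1}) − e(W/ℚ_n)` of Greenberg's Euler characteristic up the cyclotomic tower (`‖N_{Λ/Λ_m} f_X (0)‖` over the layer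
`ℚ_m`, Thm. 4.1 over number fields); on the clean cell (one totally ramified prime over `2` with `#Ẽ(𝔽₂)² = 4` at every layer, odd Tamagawa
numbers, no `2`-torsion) `V_{n+1} = ord₂ #Ш(W/ℚ_{n+1})[2^∞] − ord₂ #Ш(W/ℚ_n)[2^∞]`, so the door reads **«`#Ш[2^∞]` grows by at most `2^{2ⁿ}`
from layer `n` to layer `n+1` ⟹ `μ₂(W) = 0`»**; at layer `2` (`ℚ_2 = ℚ(ζ₁₆)⁺`, the two conductor-`16` characters): `#Ш(W/ℚ(ζ₁₆)⁺)[2^∞] =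
4·#Ш(W/ℚ(√2))[2^∞]` ⟺ `μ = 0 ∧ λ = 2` — this LIGHTS exactly the «doubly dark» clean classes of g49 (`ord₂ f_X(0) = ord₂ f_X(−2) = 2`, every
layer-`≤ 1` door provably silent) that have `λ = 2`. The analytic twin (Birch sums `∑_a χ(a)[a/2^{n+3}]⁺` at the boundary valuation) is
`…LayerValueAnalytic`. HONEST SCOPE: the layer value is a DISPLAYED per-curve input of the same tier as `O1.TowerGapAtTwo` / the twin value;
no particular curve is certified in this file; BSD is not proved by any of this.

References: R. Greenberg, LNM 1716 (1999), Thm. 4.1 (p. 102), §4 pp. 105–108 [GreenbergLNM1716]; L. Washington, GTM 83, §7.2, §13.3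
[Washington1997]; K. Kato, Astérisque 295 (2004), Thm. 17.4 [Kato2004Asterisque]; B. Mazur, J. Tate, J. Teitelbaum, Invent. Math. 84 (1986)
Ch. I §13–14 [MazurTateTeitelbaum1986Invent]; A. Abbes, E. Ullmo, Compositio 103 (1996) Thm. A [AbbesUllmo1996].
-/

set_option linter.dupNamespace false
set_option autoImplicit false

noncomputable section

open scoped Classical MatrixGroups ModularForm

namespace Summit.BirchSwinnertonDyer.BirchSwinnertonDyer.Theorems.AlignedTransportAtTwoLayerValueDoor

open PowerSeries CongruenceSubgroup WeierstrassCurve Literature.NumberTheory.EllipticCurves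
  Literature.NumberTheory.EllipticCurves.IwasawaAlgebra
  Literature.NumberTheory.EllipticCurves.ModularForms
  Literature.NumberTheory.EllipticCurves.Rank1Residual
  Literature.NumberTheory.EllipticCurves.Rank1Residual.Typed
  Literature.NumberTheory.EllipticCurves.Greenberg1999
  Summit.BirchSwinnertonDyer.Rank1Residual
  Summit.BirchSwinnertonDyer.Rank1Residual.X1.MuLambda
  Summit.BirchSwinnertonDyer.Rank1Residual.X1.MuPart
  Summit.BirchSwinnertonDyer.Rank1Residual.X1.ParitySqueeze
  Summit.BirchSwinnertonDyer.Rank1Residual.X5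
  Summit.BirchSwinnertonDyer.Rank1Residual.F1Sign2
  Summit.BirchSwinnertonDyer.Rank1Residual.Iwasawa
  Summit.BirchSwinnertonDyer.Rank1Residual.Supersingular
  Summit.BirchSwinnertonDyer.BirchSwinnertonDyer.Theorems
  Summit.BirchSwinnertonDyer.BirchSwinnertonDyer.Theorems.Rank1ResidualX1Defs
  Summit.BirchSwinnertonDyer.BirchSwinnertonDyer.Theorems.AlignedTransportAtTwoSeed
  Summit.BirchSwinnertonDyer.BirchSwinnertonDyer.Theorems.AlignedTransportAtTwoCyclotomicLayerWeightEuler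
  Summit.BirchSwinnertonDyer.BirchSwinnertonDyer.Theorems.AlignedTransportAtTwoTwistSaturation
  Summit.BirchSwinnertonDyer.BirchSwinnertonDyer.Theorems.AlignedTransportAtTwoTwinValue
  Summit.BirchSwinnertonDyer.BirchSwinnertonDyer.Theorems.AlignedTransportAtTwoTwinValueLambda
  Summit.BirchSwinnertonDyer.BirchSwinnertonDyer.Theorems.AlignedTransportAtTwoLayerValueBoundary
  Summit.BirchSwinnertonDyer.BirchSwinnertonDyer.Theorems.TwoAdicEulerCharKernel

/-! ## §0 Bookkeeping: the Euler weight as a `ℂ₂`-norm -/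

section Bookkeeping

/-- `‖x‖₂ = 2^{−w}` with `w ≠ 1` gives `x ≠ 0` and `‖ι_ℂ x‖ ≠ 1/2` for the structure map `ι_ℂ : ℤ₂ → ℂ₂`. [folklore] -/
theorem norm_algebraMap_ne_inv_of_norm_eq_pow {x : ℤ_[2]} {w : ℕ} (h : ‖x‖ = (2 : ℝ)⁻¹ ^ w) (hw : w ≠ 1) :
    x ≠ 0 ∧ ‖((algebraMap ℚ_[2] ℂ_[2]).comp (algebraMap ℤ_[2] ℚ_[2])) x‖ ≠ ((2 : ℕ) : ℝ)⁻¹ := by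
  have hx : x ≠ 0 := by
    intro h0
    rw [h0, norm_zero] at h
    exact (pow_ne_zero _ (by norm_num : ((2 : ℝ)⁻¹) ≠ 0)) h.symm
  refine ⟨hx, ?_⟩
  rw [norm_algebraMap_comp_apply, h]
  intro heq
  have h2 : ((2 : ℕ) : ℝ)⁻¹ = (2 : ℝ)⁻¹ ^ 1 := by norm_num
  rw [h2] at heq
  exact hw (pow_right_injective₀ (by norm_num) (by norm_num) heq)

/-- `‖x‖₂ = 2^{−w}` with `2 ≤ w` gives `‖ι_ℂ x‖ < 1/2`. [folklore] -/
theorem norm_algebraMap_lt_inv_of_norm_eq_pow {x : ℤ_[2]} {w : ℕ} (h : ‖x‖ = (2 : ℝ)⁻¹ ^ w) (hw : 2 ≤ w) :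
    ‖((algebraMap ℚ_[2] ℂ_[2]).comp (algebraMap ℤ_[2] ℚ_[2])) x‖ < ((2 : ℕ) : ℝ)⁻¹ := by
  rw [norm_algebraMap_comp_apply, h]
  calc (2 : ℝ)⁻¹ ^ w ≤ (2 : ℝ)⁻¹ ^ 2 := pow_le_pow_of_le_one (by norm_num) (by norm_num) hw
    _ < (2 : ℝ)⁻¹ ^ 1 := pow_lt_pow_right_of_lt_one₀ (by norm_num) (by norm_num) (by norm_num)
    _ = ((2 : ℕ) : ℝ)⁻¹ := by norm_num

/-- `φ(2ⁿ⁺¹) = 2ⁿ`. [folklore] -/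
theorem totient_two_pow_succ (n : ℕ) : Nat.totient (2 ^ (n + 1)) = 2 ^ n := by
  rw [Nat.totient_prime_pow Nat.prime_two (Nat.succ_pos n)]
  simp

end Bookkeeping

/-! ## §1 Datum level: the layer-value door for `X(W/ℚ_∞)` -/

section Datum

variable (κ : ZpExtension ℚ 2) (hκ : κ.IsCyclotomic) {γ : Field.absoluteGaloisGroup ℚ} (hγ : κ.IsTopGenerator γ)
  (hγ' : IsCyclotomicVariable 2 γ) (W : WeierstrassCurve ℚ) [W.IsElliptic] [W.IsGloballyMinimal]

include hκ hγ hγ' in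
/-- ★★★ **THE LAYER-VALUE DOOR, datum level.** `W/ℚ` globally minimal, good ordinary at `2`, `Sel_{2^∞}(W/ℚ)` finite; `(κ, γ)` the
cyclotomic `ℤ₂`-extension with a normalised topological generator, `D` any Pontryagin-dual datum of `Sel_{2^∞}(W/ℚ_∞)`, `f_X` any generator of
`char_Λ D.X`; `#W(ℚ)[2^∞] = 2^t`, `#Ẽ(𝔽₂)[2^∞] = 2^e`, `#Sel_{2^∞}(W/ℚ) = 2^s`, Euler weight `w = ord₂ ∏c_ℓ + 2e + s − 2t ≠ 1` (automatic when
`t = 0`, `e ≥ 1`). If **`‖f_X(z)‖₂ ≥ 1/2` at ONE point `z` of the open unit disc of `ℂ₂`** (`f_X(z) = ∑_k ι(f_k) z^k`), then **`μ(X(W/ℚ_∞)) = 0`**.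
Proof: `‖f_X(0)‖₂ = 2^{−w} ≠ 1/2` (Thm. 4.1, kernel) and the closed one-value certificate. NO `ι`-invariance, NO rational point, NO twist.
[cite: GreenbergLNM1716, Thm. 4.1 (p. 102)] [cite: Washington1997, §7.1–7.2 and Thm. 7.3] -/
theorem mu_eq_zero_of_layerValue (hord : IsOrdinaryAt W 2) (D : W.SelmerDualData κ γ) (hfin : Finite (W.selmerGroupPInfty 2))
    {t e s : ℕ} (ht : Nat.card (AddCommGroup.primaryComponent W.toAffine.Point 2) = 2 ^ t)
    (he : Nat.card (AddCommGroup.primaryComponent ((integralModelInt W).map (Int.castRingHom (ZMod 2))).toAffine.Point 2) = 2 ^ e)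
    (hs : Nat.card (W.selmerGroupPInfty 2) = 2 ^ s) (hw : padicValNat 2 W.tamagawaProduct + 2 * e + s - 2 * t ≠ 1)
    {fX : IwasawaAlgebra 2} (hchar : D.charIdeal = Ideal.span {fX}) {z : ℂ_[2]} (hz : ‖z‖ < 1)
    (hval : ((2 : ℕ) : ℝ)⁻¹ ≤ ‖∑' k, ((algebraMap ℚ_[2] ℂ_[2]).comp (algebraMap ℤ_[2] ℚ_[2])) (PowerSeries.coeff k fX) * z ^ k‖) :
    D.mu = 0 := by
  haveI : Module.Finite (IwasawaAlgebra 2) D.X := D.module_finite_holds hγ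
  have hD : D.IsTorsion := isTorsion_of_finite κ hκ hγ W hord D hfin
  obtain ⟨-, hnorm⟩ := norm_constantCoeff_charGen_eq_of_thm41 W thm41_charValue_rankZero_anyPrime_holds
    ((isOrdinaryAt_iff W 2).mp hord).1 ((isOrdinaryAt_iff W 2).mp hord).2 hκ hγ hγ' D hD hchar hfin ht he hs
  obtain ⟨hc0, hne⟩ := norm_algebraMap_ne_inv_of_norm_eq_pow hnorm hw
  have hfXne : fX ≠ 0 := fun h0 ↦ hc0 (by rw [h0, map_zero])
  have hμ : mu fX = 0 := mu_eq_zero_of_inv_le_norm_tsum hfXne hz hval hne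
  have hmufX : mu fX = D.mu := mu_generator_eq_muInvariant D.X hD hfXne hchar
  rw [← hmufX, hμ]

include hκ hγ hγ' in
/-- ★★★ **THE LAYER-VALUE DOOR AT A LAYER, SHARP: `μ(X) = 0` AND `λ(X) = 2ⁿ`.** Same setting; if for some `ζ ∈ ℂ₂` of order `2ⁿ⁺¹`
(a character of the layer `ℚ_{n+1}` of the cyclotomic tower) the BOUNDARY VALUE **`‖f_X(ζ − 1)‖₂ = 1/2`** is displayed, then **`μ(X(W/ℚ_∞)) = 0`
and `λ(X(W/ℚ_∞)) = 2ⁿ`** (`= φ(2ⁿ⁺¹)`). [cite: GreenbergLNM1716, Thm. 4.1 (p. 102)] [cite: Washington1997, §7.1–7.2 and Thm. 7.3] -/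
theorem mu_eq_zero_and_lambda_eq_of_layerValue_eq (hord : IsOrdinaryAt W 2) (D : W.SelmerDualData κ γ)
    (hfin : Finite (W.selmerGroupPInfty 2)) {t e s : ℕ} (ht : Nat.card (AddCommGroup.primaryComponent W.toAffine.Point 2) = 2 ^ t)
    (he : Nat.card (AddCommGroup.primaryComponent ((integralModelInt W).map (Int.castRingHom (ZMod 2))).toAffine.Point 2) = 2 ^ e)
    (hs : Nat.card (W.selmerGroupPInfty 2) = 2 ^ s) (hw : padicValNat 2 W.tamagawaProduct + 2 * e + s - 2 * t ≠ 1)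
    {fX : IwasawaAlgebra 2} (hchar : D.charIdeal = Ideal.span {fX}) {n : ℕ} {ζ : ℂ_[2]} (hζ : IsPrimitiveRoot ζ (2 ^ (n + 1)))
    (hval : ‖∑' k, ((algebraMap ℚ_[2] ℂ_[2]).comp (algebraMap ℤ_[2] ℚ_[2])) (PowerSeries.coeff k fX) * (ζ - 1) ^ k‖ =
      ((2 : ℕ) : ℝ)⁻¹) :
    D.mu = 0 ∧ D.lambda = 2 ^ n := by
  haveI : Module.Finite (IwasawaAlgebra 2) D.X := D.module_finite_holds hγ
  have hD : D.IsTorsion := isTorsion_of_finite κ hκ hγ W hord D hfin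
  obtain ⟨-, hnorm⟩ := norm_constantCoeff_charGen_eq_of_thm41 W thm41_charValue_rankZero_anyPrime_holds
    ((isOrdinaryAt_iff W 2).mp hord).1 ((isOrdinaryAt_iff W 2).mp hord).2 hκ hγ hγ' D hD hchar hfin ht he hs
  obtain ⟨hc0, hne⟩ := norm_algebraMap_ne_inv_of_norm_eq_pow hnorm hw
  have hfXne : fX ≠ 0 := fun h0 ↦ hc0 (by rw [h0, map_zero])
  obtain ⟨hμ, hlam⟩ := mu_eq_zero_and_lam_eq_totient_of_norm_tsum_eq_inv hfXne hζ hval hne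
  rw [totient_two_pow_succ] at hlam
  have hmufX : mu fX = D.mu := mu_generator_eq_muInvariant D.X hD hfXne hchar
  have hlamfX : lam fX = D.lambda := lam_generator_eq_lambdaInvariant D.X hD hfXne hchar
  exact ⟨by rw [← hmufX, hμ], by rw [← hlamfX, hlam]⟩

include hκ hγ hγ' in
/-- ★★★ **LAYER TWO: `μ(X) = 0 ∧ λ(X) = 2` from ONE value at a primitive FOURTH root of unity** (`ζ² = −1`; the two conductor-`16` characters
of `ℚ_2 = ℚ(ζ₁₆)⁺`): `‖f_X(ζ − 1)‖₂ = 1/2` ⟹ `μ(X(W/ℚ_∞)) = 0 ∧ λ(X(W/ℚ_∞)) = 2` — the door that LIGHTS a «doubly dark» class (`ord₂ f_X(0) =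
ord₂ f_X(−2) = 2`) with `λ = 2`, where every layer-`≤ 1` value or zero is provably silent. [cite: GreenbergLNM1716, Thm. 4.1 (p. 102)]
[cite: Washington1997, §7.1–7.2 and Thm. 7.3] -/
theorem mu_eq_zero_and_lambda_eq_two_of_layerTwoValue (hord : IsOrdinaryAt W 2) (D : W.SelmerDualData κ γ)
    (hfin : Finite (W.selmerGroupPInfty 2)) {t e s : ℕ} (ht : Nat.card (AddCommGroup.primaryComponent W.toAffine.Point 2) = 2 ^ t)
    (he : Nat.card (AddCommGroup.primaryComponent ((integralModelInt W).map (Int.castRingHom (ZMod 2))).toAffine.Point 2) = 2 ^ e)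
    (hs : Nat.card (W.selmerGroupPInfty 2) = 2 ^ s) (hw : padicValNat 2 W.tamagawaProduct + 2 * e + s - 2 * t ≠ 1)
    {fX : IwasawaAlgebra 2} (hchar : D.charIdeal = Ideal.span {fX}) {ζ : ℂ_[2]} (hζ : IsPrimitiveRoot ζ 4)
    (hval : ‖∑' k, ((algebraMap ℚ_[2] ℂ_[2]).comp (algebraMap ℤ_[2] ℚ_[2])) (PowerSeries.coeff k fX) * (ζ - 1) ^ k‖ =
      ((2 : ℕ) : ℝ)⁻¹) :
    D.mu = 0 ∧ D.lambda = 2 := by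
  have hζ' : IsPrimitiveRoot ζ (2 ^ (1 + 1)) := by norm_num; exact hζ
  have h := mu_eq_zero_and_lambda_eq_of_layerValue_eq κ hκ hγ hγ' W hord D hfin ht he hs hw hchar hζ' hval
  rw [pow_one] at h
  exact h

include hκ hγ hγ' in
/-- ★★ **EXACTNESS: the door at layer `n+1` is exactly the locus `λ(X) = 2ⁿ` (given `μ = 0`).** Same setting with `2 ≤ w`; if `μ(X(W/ℚ_∞)) = 0`
and `λ(X(W/ℚ_∞)) = 2ⁿ`, then **every** generator `f_X` and **every** `ζ` of order `2ⁿ⁺¹` give `‖f_X(ζ − 1)‖₂ = 1/2` (the tree's strict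
certificate reads `λ = 2ⁿ` first at layer `n + 2`). [cite: GreenbergLNM1716, Thm. 4.1 (p. 102)] [cite: Washington1997, §7.1–7.2 and Thm. 7.3] -/
theorem norm_charGen_layer_eq_inv_of_lambda_eq (hord : IsOrdinaryAt W 2) (D : W.SelmerDualData κ γ)
    (hfin : Finite (W.selmerGroupPInfty 2)) {t e s : ℕ} (ht : Nat.card (AddCommGroup.primaryComponent W.toAffine.Point 2) = 2 ^ t)
    (he : Nat.card (AddCommGroup.primaryComponent ((integralModelInt W).map (Int.castRingHom (ZMod 2))).toAffine.Point 2) = 2 ^ e)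
    (hs : Nat.card (W.selmerGroupPInfty 2) = 2 ^ s) (hw : 2 ≤ padicValNat 2 W.tamagawaProduct + 2 * e + s - 2 * t)
    {fX : IwasawaAlgebra 2} (hchar : D.charIdeal = Ideal.span {fX}) {n : ℕ} (hμ : D.mu = 0) (hlam : D.lambda = 2 ^ n)
    {ζ : ℂ_[2]} (hζ : IsPrimitiveRoot ζ (2 ^ (n + 1))) :
    ‖∑' k, ((algebraMap ℚ_[2] ℂ_[2]).comp (algebraMap ℤ_[2] ℚ_[2])) (PowerSeries.coeff k fX) * (ζ - 1) ^ k‖ = ((2 : ℕ) : ℝ)⁻¹ := by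
  haveI : Module.Finite (IwasawaAlgebra 2) D.X := D.module_finite_holds hγ
  have hD : D.IsTorsion := isTorsion_of_finite κ hκ hγ W hord D hfin
  obtain ⟨-, hnorm⟩ := norm_constantCoeff_charGen_eq_of_thm41 W thm41_charValue_rankZero_anyPrime_holds
    ((isOrdinaryAt_iff W 2).mp hord).1 ((isOrdinaryAt_iff W 2).mp hord).2 hκ hγ hγ' D hD hchar hfin ht he hs
  obtain ⟨hc0, -⟩ := norm_algebraMap_ne_inv_of_norm_eq_pow hnorm (by omega)
  have hfXne : fX ≠ 0 := fun h0 ↦ hc0 (by rw [h0, map_zero])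
  have hlt := norm_algebraMap_lt_inv_of_norm_eq_pow hnorm hw
  have hmufX : mu fX = D.mu := mu_generator_eq_muInvariant D.X hD hfXne hchar
  have hlamfX : lam fX = D.lambda := lam_generator_eq_lambdaInvariant D.X hD hfXne hchar
  have hμf : mu fX = 0 := by rw [hmufX, hμ]
  have hlamf : lam fX = Nat.totient (2 ^ (n + 1)) := by rw [hlamfX, hlam, totient_two_pow_succ]
  exact norm_tsum_eq_inv_of_lam_eq_totient hfXne hμf hζ hlamf hlt

include hκ hγ hγ' in
/-- ★★ **PAST THE DOOR**: same setting with `2 ≤ w`; if `μ(X) = 0` and `λ(X) > 2ⁿ` then `‖f_X(ζ − 1)‖₂ < 1/2` at every `ζ` of order `2ⁿ⁺¹` —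
so on a class with `μ = 0` the layer-`(n+1)` value is `< 1/2`, `= 1/2`, `> 1/2` according as `λ > 2ⁿ`, `= 2ⁿ`, `< 2ⁿ`.
[cite: GreenbergLNM1716, Thm. 4.1 (p. 102)] [cite: Washington1997, §7.1–7.2 and Thm. 7.3] -/
theorem norm_charGen_layer_lt_inv_of_lt_lambda (hord : IsOrdinaryAt W 2) (D : W.SelmerDualData κ γ)
    (hfin : Finite (W.selmerGroupPInfty 2)) {t e s : ℕ} (ht : Nat.card (AddCommGroup.primaryComponent W.toAffine.Point 2) = 2 ^ t)
    (he : Nat.card (AddCommGroup.primaryComponent ((integralModelInt W).map (Int.castRingHom (ZMod 2))).toAffine.Point 2) = 2 ^ e)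
    (hs : Nat.card (W.selmerGroupPInfty 2) = 2 ^ s) (hw : 2 ≤ padicValNat 2 W.tamagawaProduct + 2 * e + s - 2 * t)
    {fX : IwasawaAlgebra 2} (hchar : D.charIdeal = Ideal.span {fX}) {n : ℕ} (hμ : D.mu = 0) (hlam : 2 ^ n < D.lambda)
    {ζ : ℂ_[2]} (hζ : IsPrimitiveRoot ζ (2 ^ (n + 1))) :
    ‖∑' k, ((algebraMap ℚ_[2] ℂ_[2]).comp (algebraMap ℤ_[2] ℚ_[2])) (PowerSeries.coeff k fX) * (ζ - 1) ^ k‖ < ((2 : ℕ) : ℝ)⁻¹ := by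
  haveI : Module.Finite (IwasawaAlgebra 2) D.X := D.module_finite_holds hγ
  have hD : D.IsTorsion := isTorsion_of_finite κ hκ hγ W hord D hfin
  obtain ⟨-, hnorm⟩ := norm_constantCoeff_charGen_eq_of_thm41 W thm41_charValue_rankZero_anyPrime_holds
    ((isOrdinaryAt_iff W 2).mp hord).1 ((isOrdinaryAt_iff W 2).mp hord).2 hκ hγ hγ' D hD hchar hfin ht he hs
  obtain ⟨hc0, -⟩ := norm_algebraMap_ne_inv_of_norm_eq_pow hnorm (by omega)
  have hfXne : fX ≠ 0 := fun h0 ↦ hc0 (by rw [h0, map_zero])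
  have hlt := norm_algebraMap_lt_inv_of_norm_eq_pow hnorm hw
  have hmufX : mu fX = D.mu := mu_generator_eq_muInvariant D.X hD hfXne hchar
  have hlamfX : lam fX = D.lambda := lam_generator_eq_lambdaInvariant D.X hD hfXne hchar
  have hμf : mu fX = 0 := by rw [hmufX, hμ]
  have hlamf : Nat.totient (2 ^ (n + 1)) < lam fX := by rw [hlamfX, totient_two_pow_succ]; exact hlam
  exact norm_tsum_lt_inv_of_totient_lt_lam hfXne hμf hζ hlamf hlt

end Datum

/-! ## §2 On the seed cell, modulo PRINT: the layer value ⟹ Mazur's main conjecture at `2` -/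

section Seed

variable (W : WeierstrassCurve ℚ) [W.IsElliptic] [W.IsGloballyMinimal]

/-- ★★★ **THE LAYER-VALUE DOOR ON THE SEED CELL, modulo PRINT.** `W` globally minimal, good ordinary at `2`, no rational point of order `2`,
`r_an(W) = 0`, `BSD(W,2)` (C2's own binders); PRINT `h17` (Kato 17.4 (1)(2) at `2`), `hper` (period unit), `hmod` (modularity), `hGZK`
(Gross–Zagier–Kolyvagin) — Greenberg's Thm. 4.1 is the tree theorem and NO Thm. 1.14 is needed. DATA: `#W(ℚ)[2^∞] = 2^t`, `#Ẽ(𝔽₂)[2^∞] = 2^e`,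
`#Sel_{2^∞}(W/ℚ) = 2^s` with `ord₂ ∏c_ℓ + 2e + s − 2t ≠ 1`, and at every normalised cyclotomic dual datum the DISPLAYED LAYER VALUE: a generator
`f_X` of `char_Λ X` and a point `z` of the open unit disc of `ℂ₂` (e.g. `z = ζ_{2ⁿ⁺¹} − 1`) with `‖f_X(z)‖₂ ≥ 1/2`. Then **Mazur's `2`-adic main
conjecture holds for `W`** (§1 + the Seed door `mazurMainConjecture_two_of_bsdp_of_mu_eq_zero`; C2's analytic-`μ` binder is idle).
[cite: Kato2004Asterisque, Thm. 17.4 (1)(2) (p. 273)] [cite: GreenbergLNM1716, Thm. 4.1 (p. 102)] [cite: AbbesUllmo1996, Thm. A] -/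
theorem mazurMainConjecture_two_of_bsdp_of_layerValue
    (h17 : ∀ [NeZero (W.conductorNorm ℤ)] (f : CuspForm (Gamma0 (W.conductorNorm ℤ)) 2),
      kato_divisibility_allPrimes W 2 (f := f))
    (hper : realPeriodRat_eq_unit_mul_plusPeriod_two) (hmod : nonempty_modularParametrizationData)
    (hGZK : rank_eq_analyticRank_of_analyticRank_le_one)
    (hord : IsOrdinaryAt W 2) (ht2 : ∀ x : ℚ, ¬ HasRationalTwoTorsionX W x) (hr : W.analyticRank = 0) (hbsd : BSDp W 2)
    {t e s : ℕ} (ht : Nat.card (AddCommGroup.primaryComponent W.toAffine.Point 2) = 2 ^ t)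
    (he : Nat.card (AddCommGroup.primaryComponent ((integralModelInt W).map (Int.castRingHom (ZMod 2))).toAffine.Point 2) = 2 ^ e)
    (hs : Nat.card (W.selmerGroupPInfty 2) = 2 ^ s) (hw : padicValNat 2 W.tamagawaProduct + 2 * e + s - 2 * t ≠ 1)
    (hlayer : ∀ (κ : ZpExtension ℚ 2) (γ : Field.absoluteGaloisGroup ℚ), κ.IsCyclotomic → κ.IsTopGenerator γ →
      IsCyclotomicVariable 2 γ → ∀ D : W.SelmerDualData κ γ, ∃ fX : IwasawaAlgebra 2, D.charIdeal = Ideal.span {fX} ∧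
        ∃ z : ℂ_[2], ‖z‖ < 1 ∧
          ((2 : ℕ) : ℝ)⁻¹ ≤ ‖∑' k, ((algebraMap ℚ_[2] ℂ_[2]).comp (algebraMap ℤ_[2] ℚ_[2])) (PowerSeries.coeff k fX) * z ^ k‖) :
    MazurMainConjecture W 2 := by
  have hfin : Finite (W.selmerGroupPInfty 2) := finite_selmerGroupPInfty_two_of_analyticRank_eq_zero W hGZK hr
  refine mazurMainConjecture_two_of_bsdp_of_mu_eq_zero W h17 thm41_charValue_rankZero_anyPrime_holds hper hmod hGZK hord ht2 hr
    hbsd fun κ γ hκ hγ hγ' D _ ↦ ?_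
  obtain ⟨fX, hchar, z, hz, hval⟩ := hlayer κ γ hκ hγ hγ' D
  exact mu_eq_zero_of_layerValue κ hκ hγ hγ' W hord D hfin ht he hs hw hchar hz hval

/-- ★★★ **LAYER FORM of the seed door**: as above with, at every normalised datum, a generator `f_X` and a `2`-power root of unity `ζ ≠ 1`
(`ζ` of order `2ⁿ⁺¹`, some `n`) with the boundary value **`‖f_X(ζ − 1)‖₂ = 1/2`** ⟹ `MazurMainConjecture W 2` (and, datum by datum, `λ(X) = 2ⁿ`
by §1). [cite: Kato2004Asterisque, Thm. 17.4 (1)(2) (p. 273)] [cite: GreenbergLNM1716, Thm. 4.1 (p. 102)] -/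
theorem mazurMainConjecture_two_of_bsdp_of_layerValue_eq
    (h17 : ∀ [NeZero (W.conductorNorm ℤ)] (f : CuspForm (Gamma0 (W.conductorNorm ℤ)) 2),
      kato_divisibility_allPrimes W 2 (f := f))
    (hper : realPeriodRat_eq_unit_mul_plusPeriod_two) (hmod : nonempty_modularParametrizationData)
    (hGZK : rank_eq_analyticRank_of_analyticRank_le_one)
    (hord : IsOrdinaryAt W 2) (ht2 : ∀ x : ℚ, ¬ HasRationalTwoTorsionX W x) (hr : W.analyticRank = 0) (hbsd : BSDp W 2)
    {t e s : ℕ} (ht : Nat.card (AddCommGroup.primaryComponent W.toAffine.Point 2) = 2 ^ t)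
    (he : Nat.card (AddCommGroup.primaryComponent ((integralModelInt W).map (Int.castRingHom (ZMod 2))).toAffine.Point 2) = 2 ^ e)
    (hs : Nat.card (W.selmerGroupPInfty 2) = 2 ^ s) (hw : padicValNat 2 W.tamagawaProduct + 2 * e + s - 2 * t ≠ 1)
    (hlayer : ∀ (κ : ZpExtension ℚ 2) (γ : Field.absoluteGaloisGroup ℚ), κ.IsCyclotomic → κ.IsTopGenerator γ →
      IsCyclotomicVariable 2 γ → ∀ D : W.SelmerDualData κ γ, ∃ fX : IwasawaAlgebra 2, D.charIdeal = Ideal.span {fX} ∧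
        ∃ (n : ℕ) (ζ : ℂ_[2]), IsPrimitiveRoot ζ (2 ^ (n + 1)) ∧
          ‖∑' k, ((algebraMap ℚ_[2] ℂ_[2]).comp (algebraMap ℤ_[2] ℚ_[2])) (PowerSeries.coeff k fX) * (ζ - 1) ^ k‖ =
            ((2 : ℕ) : ℝ)⁻¹) :
    MazurMainConjecture W 2 := by
  refine mazurMainConjecture_two_of_bsdp_of_layerValue W h17 hper hmod hGZK hord ht2 hr hbsd ht he hs hw
    fun κ γ hκ hγ hγ' D ↦ ?_
  obtain ⟨fX, hchar, n, ζ, hζ, hval⟩ := hlayer κ γ hκ hγ hγ' D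
  exact ⟨fX, hchar, ζ - 1, (norm_sub_one_pos_and_lt_one hζ).2, hval.ge⟩

end Seed

end Summit.BirchSwinnertonDyer.BirchSwinnertonDyer.Theorems.AlignedTransportAtTwoLayerValueDoor

end
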